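/-
Copyright (c) 2026 the pub-hodgecm-mathlib formalisation cell (harness21).  Prover seat hodgecm-mathlib-K2E3-p29 (g0), HCML Track B «K2-LIT» (build stream 29),
h413 = `stmt-HodgeConjecture-24833`, line `K2_E3_EllipticInputs`, unit U12 «Characters», PART «SC» leaf (SC-an)₂ (road «FC₂», CLOSE-OUT DAY strike line L4 `stub_StCharTS`,
LINE-LEAD K2E3-plan (g4), deal D135 sequel): the (TOK₂) LETTER of the (M5h)₂ payer ★ p861288 `K2E3SupercuspidalTruncatedCharAnalyticTwoOfEllWeight.sigSCanTwo_of_ellWeightPlace_two`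
— its binder `hTOK` VERBATIM as a theorem, proved BY NAME from ★ p861252 `K2E3SupercuspidalTruncatedCharWeightKitPlaceTwo.locallyIntegrable_inv_token_mul_log_pow` (so PART «SC»
ED. 4 needs no `sig_K2E3SupercuspidalTruncatedCharTokenLocIntTwo` socket: the tie passes this name).  2026-09-04.
-/
import Summits.HodgeConjecture.HodgeConjecture.Theorems.K2E3SupercuspidalTruncatedCharWeightKitPlaceTwo   -- ★ p861252 (this seat): the UNCONDITIONAL place head `locallyIntegrable_inv_token_mul_log_pow` (over ★ (ε)₂ p861168∕p861179∕p861225)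
import HarnessLib

/-!
# h413 ∕ Track B «K2-LIT», (SC-an)₂ ∕ (M5h)₂ — THE (TOK₂) LETTER, PAID: `T⁻¹(1 + |log T|) ∈ L¹_loc(U(σ_w, Φ₂)(L_w), ν)` IN THE PAYER'S BINDER TEXT
# (Harish-Chandra 1970, Part VII §1 Theorem 15 with ε-room at rank one, §3 p. 73)

Cell `pub/hodgecm-mathlib`, crux H413 = `stmt-HodgeConjecture-24833`, route of record `HCCMUnconditional`; LINE-LEAD ∕ dealer K2E3-plan (g4) (PART «SC» ED. 4 in preparation:
K2E3-p23 (g7) 15:19:22Z artefacts `sockets_SC_ED4.txt` ∕ `tie_M5h2.body.txt`; K2E3-p33 (g0) 15:19:35Z «three sockets, not four»).  With this file the (M5h)₂ tie needs only TWO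
sockets (LIM₂, SHELL₂): `tie_M5h2.body.txt` := `K2E3SupercuspidalTruncatedCharAnalyticTwoOfEllWeight.sigSCanTwo_of_ellWeightPlace_two sig_…LimCancExplicitTwo
sig_…WeightKitShellTwo K2E3SupercuspidalTruncatedCharTokenLocIntLetterTwo.tokenLocInt_letter K2E3SupercuspidalTruncatedCharTorusDepthLettersTwo.torusOmega_letter
K2E3SupercuspidalTruncatedCharTorusDepthLettersTwo.depth_letter`.
THEOREMS ONLY (no `def`, no `instance`, no `notation`, no named-fact hypothesis, no `sorry`); lane `--supports stmt-HodgeConjecture-24833 --as helper`, count-neutral.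

* **`tokenLocInt_letter`** — the statement is the binder `hTOK` of ★ p861288 (tree `K2E3SupercuspidalTruncatedCharAnalyticTwoOfEllWeight.lean` :132–:140) VERBATIM
  (`J` fixed to `(StdForm.antidiagonal 2).over L_w`, exponent `k = 1`, ∀-closed over the CM field, the place and the Haar measure); the proof is
  `fun L _ _ _ _ w hw _ _ ν _ => …WeightKitPlaceTwo.locallyIntegrable_inv_token_mul_log_pow L w hw rfl ν 1` (tie-checked against the tree text, farm rc 0).

HONEST LABEL.  HC_CM is proved only modulo the 7 printed citations (2 remaining named inputs: hLiu418 = `stmt-HodgeConjecture-24832`, h413 = `stmt-HodgeConjecture-24833`)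
until rung 0 closes; count-neutral helper; (SC-an)₂ stays OPEN — after ED. 4 the (M5h)₂ socket is REL over (LIM₂, SHELL₂) exactly.

## References
* [HarishChandra1970] Harish-Chandra (notes by G. van Dijk), *Harmonic Analysis on Reductive p-adic Groups*, LNM 162 (1970), Part VII §1 Thm. 15 p. 63, §3 p. 73.
* [Rogawski1990] J. D. Rogawski, *Automorphic Representations of Unitary Groups in Three Variables*, Ann. of Math. Stud. 123 (1990), §4.9 p. 54, §12.5 p. 182.
-/

set_option autoImplicit false
-- the mandated namespace repeats the single-problem summit's segment (`HodgeConjecture.HodgeConjecture`)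
set_option linter.dupNamespace false

noncomputable section

open MeasureTheory Measure Set Filter Topology NumberField IsDedekindDomain
open scoped NNReal ENNReal Pointwise Matrix MatrixGroups WithZero
open ValuativeRel
open Literature.NumberTheory.Automorphic Literature.NumberTheory.Automorphic.UnitaryGroup Literature.NumberTheory.Automorphic.HermitianLattice Literature.NumberTheory.Rogawski1990
open Literature.NumberTheory.GaloisRepresentations Literature.NumberTheory.GaloisRepresentations.IsNonarchimedeanLocalField

namespace Summit.HodgeConjecture.HodgeConjecture.Cruxes.H413.K2E3SupercuspidalTruncatedCharTokenLocIntLetterTwo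

/-- **(TOK₂) — THE LETTER `hTOK` OF THE (M5h)₂ PAYER, PAID BY NAME**: for every CM field `L`, every conjugation-fixed place `w ∣ v`, every Borel structure and every Haar measure `ν`
on `U(σ_w, (StdForm.antidiagonal 2).over L_w)(L_w)`, the weight `m ↦ T(m)⁻¹ · (1 + |log T(m)|)^1`, `T = √√(‖disc χ_m‖·‖det m‖⁻²)`, is locally integrable — ★
`K2E3SupercuspidalTruncatedCharWeightKitPlaceTwo.locallyIntegrable_inv_token_mul_log_pow L w hw rfl ν 1` (★ WeightKit₂ §4 over the ★ (ε)₂ re-thread: Harish-Chandra's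
`|D|^{−1∕2−ε} ∈ L¹_loc` at rank one).  Statement = tree `K2E3SupercuspidalTruncatedCharAnalyticTwoOfEllWeight.lean` :132–:140 VERBATIM.
[cite: HarishChandra1970, Part VII §1 Thm. 15 p. 63; §3 p. 73] [cite: Rogawski1990, §4.9 p. 54] -/
theorem tokenLocInt_letter : ∀ (L : Type) [Field L] [NumberField L] [IsCMField L] {v : HeightOneSpectrum (𝓞 ↥(maximalRealSubfield L))} (w : PlacesOver L v) (hw : IsCMField.complexConj L • w.1 = w.1)
    [MeasurableSpace ↥(unitaryGroupOfForm (galAdicCompletionMap (L := L) (IsCMField.complexConj L) hw) ((StdForm.antidiagonal 2).over (w.1.adicCompletion L)))]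
    [BorelSpace ↥(unitaryGroupOfForm (galAdicCompletionMap (L := L) (IsCMField.complexConj L) hw) ((StdForm.antidiagonal 2).over (w.1.adicCompletion L)))]
    (ν : Measure ↥(unitaryGroupOfForm (galAdicCompletionMap (L := L) (IsCMField.complexConj L) hw) ((StdForm.antidiagonal 2).over (w.1.adicCompletion L)))) [ν.IsHaarMeasure],
    LocallyIntegrable (fun m : ↥(unitaryGroupOfForm (galAdicCompletionMap (L := L) (IsCMField.complexConj L) hw) ((StdForm.antidiagonal 2).over (w.1.adicCompletion L))) =>
    (((NNReal.sqrt (NNReal.sqrt (normAbs (w.1.adicCompletion L) (((m : GL (Fin 2) (w.1.adicCompletion L)) : Matrix (Fin 2) (Fin 2) (w.1.adicCompletion L))).charpoly.discr *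
    (normAbs (w.1.adicCompletion L) (((m : GL (Fin 2) (w.1.adicCompletion L)) : Matrix (Fin 2) (Fin 2) (w.1.adicCompletion L))).det ^ 2)⁻¹)) : ℝ≥0) : ℝ))⁻¹ *
    (1 + |Real.log (((NNReal.sqrt (NNReal.sqrt (normAbs (w.1.adicCompletion L) (((m : GL (Fin 2) (w.1.adicCompletion L)) : Matrix (Fin 2) (Fin 2) (w.1.adicCompletion L))).charpoly.discr *
    (normAbs (w.1.adicCompletion L) (((m : GL (Fin 2) (w.1.adicCompletion L)) : Matrix (Fin 2) (Fin 2) (w.1.adicCompletion L))).det ^ 2)⁻¹)) : ℝ≥0) : ℝ))|) ^ 1) ν  :=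
  fun L _ _ _ _ w hw _ _ ν _ => K2E3SupercuspidalTruncatedCharWeightKitPlaceTwo.locallyIntegrable_inv_token_mul_log_pow L w hw rfl ν 1

end Summit.HodgeConjecture.HodgeConjecture.Cruxes.H413.K2E3SupercuspidalTruncatedCharTokenLocIntLetterTwo

end
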